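import Summits.ValiantsHypothesis.ValiantsHypothesis.Theorems.GrenetZeonDualUnipotentThreeHalvesWordFlagPencil
import Summits.ValiantsHypothesis.ValiantsHypothesis.Theorems.DualUnipotentThreeHalves.Negative.HeavyTopVacuousSmallM
import Literature.LinearAlgebra.Matrix.GerstenhaberNilpotentSubspace

/-!
# `GrenetZeon.DualUnipotentThreeHalves` (stmt-ValiantsHypothesis-24318) — line «radical_split» §8 (P-i):
# TOPS OF AN AFFINE NILPOTENT PENCIL ARE NILPOTENT, and THE QUADRATIC BAND OF R2 / S3b IS TRUE

Port (val-lit merged desk, b71 (B) port pool; porter val-port-1 g2; text = val-idea-9 g4's §8, VERBATIM, credited; named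
port candidate «P-i» of val-idea-9 g4's hand-off 2026-08-28 11:55Z) of `Cruxes/DualUnipotentThreeHalves/Lines/radical_split.lean`
@749d8538785a §8, first part, over the Theorems-side vocabulary (`…WordDefs`: `HeavyTopInst`, `FlagCheap`, `linPart`,
`WordTame`, …, definitionally the workfile's) and the word–flag duality (`…WordFlagPencil.flagCheap_iff_wordTame`).

`HeavyTopInst n m` is the body of R2 `HeavyTopLaw` at ONE format `(n, m)` (`heavyTopLaw_iff_inst`, `Iff.rfl`).

* `linPart_pow_eq_zero` — **tops of an affine nilpotent pencil are nilpotent**: `N_lin(v)^m = 0`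
  (`s·N(s⁻¹v) = s·N(0) + N_lin(v)` is nilpotent for `s ≠ 0`; nilpotents are closed; `s → 0`); `map_eval_pow_eq_zero`.
* `finrank_range_top_le_choose_two` — Gerstenhaber: `dim N_lin(ℂ^{n×n}) ≤ m(m−1)/2`
  (the tree's `Literature.LinearAlgebra.Matrix.GerstenhaberNilpotentSubspace.finrank_le_choose_two`).
* `flagCheap_of_finrank_range_lt` — KERNEL TRIVIALITY: top space of dimension `< n² − n` ⇒ flag-cheap with budget `0` on
  `K = ker N_lin` (pairs `(N(x), 0)` are word-tame with budget `0`: `wordTame_zero_right`).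
* ★ `flagCheap_of_choose_two_add_lt` / `heavyTopInst_of_choose_two_add_lt` — **THE QUADRATIC BAND IS TRUE**: for
  `m(m−1)/2 + n < n²` EVERY affine nilpotent `m × m` pencil over `ℂ^{n×n}` is flag-cheap (heavy-top hypothesis unused);
  `heavyTopInst_of_le` — in particular every format `m ≤ n`, `2 ≤ n` (contains the vacuity range of ✓ p619580).
* `format_three_four` — bookkeeping: `(3,4)` is the first admissible format outside the band for `C₀ = 1`
  (`(5,7)`, `(7,10)` for `C₀ = 2, 3`).

Honest framing.  Helper lemmas (`--supports stmt-ValiantsHypothesis-24318 --as helper`): instances of R2 decided TRUE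
trivially (outcome B of director R227) — an honest but weak rung; R2 `HeavyTopLaw` itself (all admissible formats, uniform
constants), S3b, the crux `DualUnipotentThreeHalves`, rung 8062 and `VP ≠ VNP` are untouched / NOT proved.
[this line's workfile; Gerstenhaber 1958 / de Seguins Pazzis 2013 via the tree's Literature file; ✓ p619580 `exists_topMap`]
-/

-- `Summit.ValiantsHypothesis.ValiantsHypothesis.…` repeats a component by the D-0017 layout
-- (single-conjunct summit), which the `dupNamespace` linter flags; the name is mandated.
set_option linter.dupNamespace false

noncomputable section

namespace Summit.ValiantsHypothesis.ValiantsHypothesis.Theorems.GrenetZeon.RadicalSplit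

open MvPolynomial Matrix
open scoped BigOperators
open Summit.ValiantsHypothesis.ValiantsHypothesis.Cruxes.TwoDimCoefficients.DimTwoCases (AffMat IsAffine)
open Summit.ValiantsHypothesis.ValiantsHypothesis.Theorems.DualUnipotentThreeHalvesNegative.RadicalSplit (exists_topMap)
open Literature.LinearAlgebra.Matrix.GerstenhaberNilpotentSubspace (finrank_le_choose_two)

variable {m : ℕ}

/-- R2 is «`HeavyTopInst n m` on every admissible format». [definitional] -/
theorem heavyTopLaw_iff_inst :
    HeavyTopLaw ↔ ∃ C₀ n₀ : ℕ, ∀ n ≥ n₀, ∀ m : ℕ, C₀ * m ^ 2 < n ^ 3 → HeavyTopInst n m :=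
  Iff.rfl

/-- The top map as a linear map (✓ p619580 `exists_topMap`, restated with `linPart`). -/
theorem exists_topMap_linPart {n : ℕ} (N : AffMat n m) (hN : IsAffine N) :
    ∃ T : (Fin n × Fin n → ℂ) →ₗ[ℂ] Matrix (Fin m) (Fin m) ℂ, ∀ v, T v = linPart N v :=
  exists_topMap N hN

/-- Evaluations of a nilpotent polynomial pencil are nilpotent: `N(x)^m = 0`. -/
theorem map_eval_pow_eq_zero {n : ℕ} (N : AffMat n m) (hnil : N ^ m = 0) (x : Fin n × Fin n → ℂ) :
    N.map (MvPolynomial.eval x) ^ m = 0 := by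
  have h := Matrix.map_pow N (MvPolynomial.eval x) m
  rw [hnil, Matrix.map_zero _ (map_zero _)] at h
  exact h.symm

/-- **Tops of an affine nilpotent pencil are nilpotent**: `N_lin(v)^m = 0` (`s·N(s⁻¹·v) = s·N(0) + N_lin(v)` is nilpotent for
`s ≠ 0`; the nilpotent matrices are closed; let `s → 0`). [folklore] -/
theorem linPart_pow_eq_zero {n : ℕ} (N : AffMat n m) (hN : IsAffine N) (hnil : N ^ m = 0) (v : Fin n × Fin n → ℂ) :
    linPart N v ^ m = 0 := by
  obtain ⟨T, hT⟩ := exists_topMap N hN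
  set A := N.map (MvPolynomial.eval 0) with hA
  have hlin : ∀ w, linPart N w = T w := fun w => (hT w).symm
  have hpath : ∀ s : ℂ, s ≠ 0 → (s • A + linPart N v) ^ m = 0 := by
    intro s hs
    have h2 : N.map (MvPolynomial.eval (s⁻¹ • v)) = A + T (s⁻¹ • v) := by
      rw [hT]; abel
    have h1 : s • A + linPart N v = s • N.map (MvPolynomial.eval (s⁻¹ • v)) := by
      rw [h2, map_smul, smul_add, smul_smul, mul_inv_cancel₀ hs, one_smul, hlin v]
    rw [h1, smul_pow, map_eval_pow_eq_zero N hnil, smul_zero]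
  have hcont : Continuous fun s : ℂ => (s • A + linPart N v) ^ m :=
    ((continuous_id.smul continuous_const).add continuous_const).pow m
  have heq : (fun s : ℂ => (s • A + linPart N v) ^ m) = fun _ => 0 :=
    Continuous.ext_on (dense_compl_singleton 0) hcont continuous_const fun s hs => hpath s hs
  simpa using congr_fun heq 0

/-- **Gerstenhaber bound for the top space**: `dim N_lin(ℂ^{n×n}) ≤ m(m−1)/2`.
[Gerstenhaber 1958 / de Seguins Pazzis 2013 Thm. 1, via `Literature…GerstenhaberNilpotentSubspace.finrank_le_choose_two`] -/
theorem finrank_range_top_le_choose_two {n : ℕ} (N : AffMat n m) (hN : IsAffine N) (hnil : N ^ m = 0)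
    (T : (Fin n × Fin n → ℂ) →ₗ[ℂ] Matrix (Fin m) (Fin m) ℂ) (hT : ∀ v, T v = linPart N v) :
    Module.finrank ℂ (LinearMap.range T) ≤ m.choose 2 := by
  refine finrank_le_choose_two m (LinearMap.range T) fun A hA => ?_
  obtain ⟨v, rfl⟩ := LinearMap.mem_range.1 hA
  exact ⟨m, by rw [hT]; exact linPart_pow_eq_zero N hN hnil v⟩

/-- **KERNEL TRIVIALITY.**  If the top space has dimension `< n² − n`, the pencil is flag-cheap: budget `0` on
`K = ker N_lin` (pairs `(N(x), 0)`), `dim K = n² − dim(tops) > n`. [this file] -/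
theorem flagCheap_of_finrank_range_lt {n : ℕ} (N : AffMat n m) (hN : IsAffine N)
    (T : (Fin n × Fin n → ℂ) →ₗ[ℂ] Matrix (Fin m) (Fin m) ℂ) (hT : ∀ v, T v = linPart N v)
    (h : Module.finrank ℂ (LinearMap.range T) + n < n * n) : FlagCheap n m N := by
  rw [flagCheap_iff_wordTame N hN]
  refine ⟨LinearMap.ker T, 0, ?_, fun x v hv => ?_⟩
  · have hrn := LinearMap.finrank_range_add_finrank_ker T
    have hV : Module.finrank ℂ (Fin n × Fin n → ℂ) = n * n := by
      simp [Module.finrank_fintype_fun_eq_card]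
    rw [hV] at hrn
    generalize n * n = S at hrn h
    omega
  · rw [LinearMap.mem_ker] at hv
    rw [← hT v, hv]
    exact wordTame_zero_right n _

/-- **THE QUADRATIC BAND OF R2 / S3b IS TRUE.**  For `m(m−1)/2 + n < n²` every affine nilpotent `m × m` pencil over `ℂ^{n×n}`
is flag-cheap. [this file + Gerstenhaber] -/
theorem flagCheap_of_choose_two_add_lt {n : ℕ} (h : m.choose 2 + n < n * n) (N : AffMat n m) (hN : IsAffine N)
    (hnil : N ^ m = 0) : FlagCheap n m N := by
  obtain ⟨T, hT⟩ := exists_topMap_linPart N hN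
  have := finrank_range_top_le_choose_two N hN hnil T hT
  exact flagCheap_of_finrank_range_lt N hN T hT (by generalize n * n = S at h ⊢; omega)

/-- `HeavyTopInst n m` throughout the quadratic band `m(m−1)/2 + n < n²` — the heavy-top hypothesis unused. -/
theorem heavyTopInst_of_choose_two_add_lt {n m : ℕ} (h : m.choose 2 + n < n * n) : HeavyTopInst n m :=
  fun N hN hnil _ => flagCheap_of_choose_two_add_lt h N hN hnil

/-- In particular R2 is decided TRUE at every format `m ≤ n`, `2 ≤ n` (this contains the vacuity range of ✓ p619580 and the
first heavy-specific formats `(22, 2)`, `(33, 7)`). -/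
theorem heavyTopInst_of_le {n m : ℕ} (hmn : m ≤ n) (hn : 2 ≤ n) : HeavyTopInst n m := by
  refine heavyTopInst_of_choose_two_add_lt ?_
  have h1 : m.choose 2 ≤ n.choose 2 := Nat.choose_le_choose 2 hmn
  have h2 : n.choose 2 < n * n - n := by
    rw [Nat.choose_two_right]
    have hpos : 0 < n * (n - 1) := Nat.mul_pos (by omega) (by omega)
    have h3 : n * (n - 1) / 2 < n * (n - 1) := Nat.div_lt_self hpos (by norm_num)
    have h4 : n * (n - 1) = n * n - n := Nat.mul_sub_one n n
    rw [h4] at h3 ⊢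
    exact h3
  have h5 : n ≤ n * n := Nat.le_mul_self n
  generalize n * n = S at h2 h5 ⊢
  omega

/-- Format bookkeeping: `(3, 4)` is admissible for `C₀ = 1` and is the first format outside the quadratic band
(`(3, m)`, `m ≤ 3`, and `(2, m)`, `m ≤ 2`, are inside or inadmissible); `(5, 7)` resp. `(7, 10)` are the first for `C₀ = 2, 3`. -/
theorem format_three_four :
    1 * 4 ^ 2 < 3 ^ 3 ∧ ¬ (Nat.choose 4 2 + 3 < 3 * 3) ∧ Nat.choose 3 2 + 3 < 3 * 3 ∧ ¬ (1 * 3 ^ 2 < 2 ^ 3) ∧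
      (2 * 7 ^ 2 < 5 ^ 3 ∧ ¬ (Nat.choose 7 2 + 5 < 5 * 5) ∧ Nat.choose 6 2 + 5 < 5 * 5 ∧ ¬ (2 * 6 ^ 2 < 4 ^ 3)) ∧
      (3 * 10 ^ 2 < 7 ^ 3 ∧ ¬ (Nat.choose 10 2 + 7 < 7 * 7) ∧ Nat.choose 9 2 + 7 < 7 * 7 ∧ ¬ (3 * 9 ^ 2 < 6 ^ 3)) := by
  decide

end Summit.ValiantsHypothesis.ValiantsHypothesis.Theorems.GrenetZeon.RadicalSplit

end
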